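import Literature.NumberTheory.GaloisRepresentations.SuperellipticReduction
import Literature.NumberTheory.GaloisRepresentations.SuperellipticPolyEval
import HarnessLib
/-!
# Reduction of `y^p = f(x)` modulo `𝔓`: the local inequality at unramified points

Part 2 of the explicit Deuring reduction (`SuperellipticReduction`).  For `u ∈ ℤ̄_𝔓[X][Y]` write `u(x, y)` for its
image in `K̄(C_f)` (`ev`, the `polyEval` of `SuperellipticPolyEval` along `ℤ̄_𝔓 ⊂ K̄`) and `ū(x̄, ȳ)` for its image
in `κ(C_f̄)` (`evκ`, along `ℤ̄_𝔓 → κ = ℤ̄/𝔓`).  The main result `sum_ord_le_ord_of_redPlace_eq`: at an unramified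
affine point `Q̄ = (α, β)` of the special fibre (`f̄(α) ≠ 0`),
`∑_{Q ↦ Q̄} v_Q(u(x,y)) ≤ v_{Q̄}(ū(x̄,ȳ))`, the sum over the places of `K̄(C_f)` reducing to `Q̄`.  Proof: iterate
the division lemma (`exists_mul_geomSum_eq`) at all the integral points `(a_Q, b_Q)` above `Q̄` — they have pairwise
distinct `x`-coordinates (`eq_of_residue_eq`) — to get `u · E = ∏_Q (X - a_Q)^{v_Q(u)} · u' (mod Y^p - f)` with
`Ē(α, β) ≠ 0` (`exists_mul_eq_prod_pow_mul`), and reduce modulo `𝔓`, where every `X - a_Q` becomes the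
uniformizer `x̄ - α` at `Q̄`.

## References
* [cite: Deuring1942Reduktion, §3]
-/

noncomputable section

open Polynomial
open scoped NumberField Classical Polynomial.Bivariate

namespace Literature.NumberTheory.GaloisRepresentations

open Field IsDedekindDomain Literature.NumberTheory.DiophantineGeometry
  Literature.NumberTheory.DiophantineGeometry.AlgFunctionField SuperellipticFunctionField

attribute [local instance] Ideal.Quotient.field

set_option synthInstance.maxHeartbeats 160000

namespace SuperellipticReduction

variable {K : Type} [Field K] [NumberField K] {p : ℕ} [hp : Fact p.Prime] {f₀ : (𝓞 K)[X]}
variable {𝔭 : HeightOneSpectrum (𝓞 K)} {𝔓 : Ideal (absIntegers (𝓞 K) K)} [h𝔓m : 𝔓.IsMaximal] [h𝔓 : 𝔓.LiesOver 𝔭.asIdeal]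

set_option hygiene false in
local notation "K̄" => AlgebraicClosure K
set_option hygiene false in
local notation "𝒪" => absIntegersLocalization 𝔓
set_option hygiene false in
local notation "κ" => (absIntegers (𝓞 K) K ⧸ 𝔓)
set_option hygiene false in
local notation "k𝔭" => (𝓞 K ⧸ 𝔭.asIdeal)
set_option hygiene false in
local notation "fK" => (Polynomial.map (algebraMap (𝓞 K) K) f₀)
set_option hygiene false in
local notation "fk" => (Polynomial.map (Ideal.Quotient.mk 𝔭.asIdeal) f₀)
set_option hygiene false in
local notation "FK" => SuperellipticFunctionField K (AlgebraicClosure K) p (Polynomial.map (algebraMap (𝓞 K) K) f₀)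
set_option hygiene false in
local notation "Fκ" =>
  SuperellipticFunctionField (𝓞 K ⧸ 𝔭.asIdeal) (absIntegers (𝓞 K) K ⧸ 𝔓) p (Polynomial.map (Ideal.Quotient.mk 𝔭.asIdeal) f₀)
set_option hygiene false in
/-- evaluation in the generic fibre -/
local notation "ev" =>
  polyEval K p (Polynomial.map (algebraMap (𝓞 K) K) f₀) (absIntegersLocalization 𝔓).subtype
set_option hygiene false in
/-- evaluation in the special fibre -/
local notation "evκ" =>
  polyEval (𝓞 K ⧸ 𝔭.asIdeal) p (Polynomial.map (Ideal.Quotient.mk 𝔭.asIdeal) f₀) (absIntegersResidue 𝔓)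
set_option hygiene false in
/-- the model `Y^p - f_𝒪` -/
local notation "gmod" => ((X : (absIntegersLocalization 𝔓)[X][Y]) ^ p - C (fLoc f₀ 𝔓))

variable [hirrK : Fact (Irreducible (superellipticPoly K (AlgebraicClosure K) p (fK)))]
  [hirrκ : Fact (Irreducible (superellipticPoly (𝓞 K ⧸ 𝔭.asIdeal) (absIntegers (𝓞 K) K ⧸ 𝔓) p (fk)))]

/-! ### Evaluations in the two fibres -/

omit [NumberField K] in
/-- `u(x, y) = 0` in `K̄(C_f)` iff `Y^p - f_𝒪 ∣ u`. [folklore] -/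
theorem ev_eq_zero_iff (u : (absIntegersLocalization 𝔓)[X][Y]) : ev u = 0 ↔ gmod ∣ u :=
  polyEval_eq_zero_iff (absIntegersLocalization 𝔓).subtype (fLoc_map_subtype (𝔓 := 𝔓)) Subtype.coe_injective
    hp.out.ne_zero u

omit hp hirrK in
/-- `Y^p - f_𝒪 ∣ u` kills `u` in `κ(C_f̄)`. [folklore] -/
theorem evκ_eq_zero_of_dvd {u : (absIntegersLocalization 𝔓)[X][Y]} (h : gmod ∣ u) : evκ u = 0 :=
  polyEval_eq_zero_of_dvd (absIntegersResidue 𝔓) (fLoc_map_residue (𝔭 := 𝔭)) h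

/-- **Primitive elements are nonzero on the generic fibre**: `ū(x,y) ≠ 0 ⇒ u(x,y) ≠ 0`. [folklore] -/
theorem ev_ne_zero_of_evκ_ne_zero {u : (absIntegersLocalization 𝔓)[X][Y]} (hu : evκ u ≠ 0) : ev u ≠ 0 := fun h =>
  hu (evκ_eq_zero_of_dvd ((ev_eq_zero_iff u).1 h))

omit [NumberField K] hp in
/-- `(Y^p - f_𝒪)(x, y) = 0` on the generic fibre. [folklore] -/
theorem ev_gmod : ev gmod = 0 := polyEval_model (absIntegersLocalization 𝔓).subtype (fLoc_map_subtype (𝔓 := 𝔓))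

omit hp hirrK in
/-- `(Y^p - f_𝒪)(x̄, ȳ) = 0` on the special fibre. [folklore] -/
theorem evκ_gmod : evκ gmod = 0 := polyEval_model (absIntegersResidue 𝔓) (fLoc_map_residue (𝔭 := 𝔭))

omit [NumberField K] hp hirrK in
/-- The point relation `b^p = f_𝒪(a)` in `ℤ̄_𝔓` from the relation in `K̄`. [folklore] -/
theorem pow_eq_eval_fLoc {a b : 𝒪} (hb : (b : K̄) ^ p = ((fK).map (algebraMap K K̄)).eval (a : K̄)) :
    b ^ p = (fLoc f₀ 𝔓).eval a :=
  Subtype.ext (by rw [Subring.coe_pow, hb, coe_eval_fLoc])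

omit [NumberField K] in
/-- `f̄(α) ≠ 0 ⇒ f(a) ≠ 0` for `a ∈ ℤ̄_𝔓`. [folklore] -/
theorem eval_ne_zero_of_residue {a : 𝒪} (hα : ((fk).map (algebraMap k𝔭 κ)).eval (absIntegersResidue 𝔓 a) ≠ 0) :
    ((fK).map (algebraMap K K̄)).eval (a : K̄) ≠ 0 := fun h => hα (by
  rw [← residue_eval_fLoc (𝔭 := 𝔭), show (fLoc f₀ 𝔓).eval a = 0 from Subtype.ext (by rw [coe_eval_fLoc, h]; rfl), map_zero])

omit [NumberField K] in
/-- The reduced value of `u` at `(α, β) = (a, b) mod 𝔓` is the residue of `u(a, b)`. [folklore] -/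
theorem evalEval_map_residue (u : (absIntegersLocalization 𝔓)[X][Y]) (a b : 𝒪) :
    (u.map (mapRingHom (absIntegersResidue 𝔓))).evalEval (absIntegersResidue 𝔓 a) (absIntegersResidue 𝔓 b) =
      absIntegersResidue 𝔓 (u.evalEval a b) :=
  map_mapRingHom_evalEval _ _ _ _

section KValues

variable {ζ₀ : K̄} (hζ₀ : IsPrimitiveRoot ζ₀ p) (hsepK : (fK).Separable)
include hζ₀ hsepK

omit [NumberField K]

/-- `u(x,y)` vanishes at the place of the integral point `(a, b)` iff `u(a, b) = 0` in `ℤ̄_𝔓`. [folklore] -/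
theorem valuation_ev_lt_one_iff {a b : 𝒪} (hb : (b : K̄) ^ p = ((fK).map (algebraMap K K̄)).eval (a : K̄))
    (u : (absIntegersLocalization 𝔓)[X][Y]) :
    (pointPlace K K̄ p (fK) (a : K̄) (b : K̄)).valuation (ev u) < 1 ↔ u.evalEval a b = 0 := by
  have h := valuation_polyEval_lt_one_iff (absIntegersLocalization 𝔓).subtype hζ₀ hsepK (a := a) (b := b) hb u
  simp only [Subring.coe_subtype, ZeroMemClass.coe_eq_zero] at h
  exact h

/-- `v_{(a,b)}(u(x,y)) = 0 ↔ u(a, b) ≠ 0` in `ℤ̄_𝔓`. [folklore] -/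
theorem ord_ev_eq_zero_iff {a b : 𝒪} (hb : (b : K̄) ^ p = ((fK).map (algebraMap K K̄)).eval (a : K̄))
    {u : (absIntegersLocalization 𝔓)[X][Y]} (hu : ev u ≠ 0) :
    (pointPlace K K̄ p (fK) (a : K̄) (b : K̄)).ord (ev u) = 0 ↔ u.evalEval a b ≠ 0 := by
  have h := ord_polyEval_eq_zero_iff (absIntegersLocalization 𝔓).subtype hζ₀ hsepK (a := a) (b := b) hb hu
  simp only [Subring.coe_subtype, ne_eq, ZeroMemClass.coe_eq_zero] at h
  exact h

/-- `0 < v_{(a,b)}(u(x,y)) ↔ u(a, b) = 0` in `ℤ̄_𝔓`. [folklore] -/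
theorem ord_ev_pos_iff {a b : 𝒪} (hb : (b : K̄) ^ p = ((fK).map (algebraMap K K̄)).eval (a : K̄))
    {u : (absIntegersLocalization 𝔓)[X][Y]} (hu : ev u ≠ 0) :
    0 < (pointPlace K K̄ p (fK) (a : K̄) (b : K̄)).ord (ev u) ↔ u.evalEval a b = 0 := by
  have h := ord_polyEval_pos_iff (absIntegersLocalization 𝔓).subtype hζ₀ hsepK (a := a) (b := b) hb hu
  simp only [Subring.coe_subtype, ZeroMemClass.coe_eq_zero] at h
  exact h

/-- `0 ≤ v_{(a,b)}(u(x,y))`. [folklore] -/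
theorem ord_ev_nonneg {a b : 𝒪} (hb : (b : K̄) ^ p = ((fK).map (algebraMap K K̄)).eval (a : K̄))
    {u : (absIntegersLocalization 𝔓)[X][Y]} (hu : ev u ≠ 0) :
    0 ≤ (pointPlace K K̄ p (fK) (a : K̄) (b : K̄)).ord (ev u) := by
  have h := ord_polyEval_nonneg (absIntegersLocalization 𝔓).subtype hζ₀ hsepK (a := a) (b := b) hb hu
  simp only [Subring.coe_subtype] at h
  exact h

end KValues

section Local

variable (hp𝔭 : (p : 𝓞 K) ∉ 𝔭.asIdeal) {ζ₀ : K̄} (hζ₀ : IsPrimitiveRoot ζ₀ p) (hsepK : (fK).Separable)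
include hp𝔭 hζ₀ hsepK

omit [NumberField K] hirrκ hp𝔭 in
/-- **Orders at an integral point read off a factorisation `u E = (X - a)^n u' (mod Y^p - f_𝒪)`**: if `E(a, b)` is a
`𝔓`-unit and `f̄(α) ≠ 0`, then `v_{(a,b)}(u) = n + v_{(a,b)}(u')` and `u'(x,y) ≠ 0`. [folklore] -/
theorem ord_eq_add_ord_of_mul_eq {u E u' q : (absIntegersLocalization 𝔓)[X][Y]} (hu : ev u ≠ 0) {a b : 𝒪}
    (hb : (b : K̄) ^ p = ((fK).map (algebraMap K K̄)).eval (a : K̄))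
    (hα : ((fk).map (algebraMap k𝔭 κ)).eval (absIntegersResidue 𝔓 a) ≠ 0)
    (hE : absIntegersResidue 𝔓 (E.evalEval a b) ≠ 0) {ι : Type*} (T : Finset ι) (pa : ι → 𝒪) (n : ι → ℕ)
    (hpa : ∀ i ∈ T, 0 < n i → (pa i : K̄) ≠ a)
    (n₀ : ℕ) (heq : u * E = (C (X - C a) ^ n₀ * ∏ i ∈ T, C (X - C (pa i)) ^ n i) * u' + gmod * q) :
    ev u' ≠ 0 ∧
      (pointPlace K K̄ p (fK) (a : K̄) (b : K̄)).ord (ev u) = n₀ + (pointPlace K K̄ p (fK) (a : K̄) (b : K̄)).ord (ev u') := by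
  set P := pointPlace K K̄ p (fK) (a : K̄) (b : K̄) with hP
  -- evaluate the factorisation in `K̄(C_f)`
  have hev : ev u * ev E = (genX K K̄ p (fK) - algebraMap K̄ _ (a : K̄)) ^ n₀ *
      (∏ i ∈ T, (genX K K̄ p (fK) - algebraMap K̄ _ (pa i : K̄)) ^ n i) * ev u' := by
    have h := congrArg (fun w => ev w) heq
    simp only [map_mul, map_add, map_pow, map_prod, ev_gmod, zero_mul, add_zero] at h
    rw [h]
    congr 2
    · rw [polyEval_C_X_sub_C]; rfl
    · refine Finset.prod_congr rfl fun i _ => ?_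
      rw [polyEval_C_X_sub_C]; rfl
  have hE0 : ev E ≠ 0 := by
    intro h0
    have h1 : P.valuation (ev E) < 1 := by rw [h0, Valuation.map_zero]; exact zero_lt_one
    rw [hP, valuation_ev_lt_one_iff hζ₀ hsepK hb] at h1
    exact hE (by rw [h1, map_zero])
  have hxa0 : ∀ c : K̄, genX K K̄ p (fK) - algebraMap K̄ _ c ≠ 0 := fun c => genX_sub_algebraMap_ne_zero K K̄ p (fK) c
  have hprod0 : (∏ i ∈ T, (genX K K̄ p (fK) - algebraMap K̄ _ (pa i : K̄)) ^ n i) ≠ 0 :=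
    Finset.prod_ne_zero_iff.2 fun i _ => pow_ne_zero _ (hxa0 _)
  have hlhs0 : ev u * ev E ≠ 0 := mul_ne_zero hu hE0
  have hu'0 : ev u' ≠ 0 := by
    intro h0; rw [h0, mul_zero] at hev; exact hlhs0 hev
  refine ⟨hu'0, ?_⟩
  -- take orders at `P = Q_{(a,b)}`
  have hordE : P.ord (ev E) = 0 := by
    rw [hP, ord_ev_eq_zero_iff hζ₀ hsepK hb hE0]
    exact fun h0 => hE (by rw [h0, map_zero])
  have hordx : P.ord (genX K K̄ p (fK) - algebraMap K̄ _ (a : K̄)) = 1 :=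
    ord_pointPlace_genX_sub_of_eval_ne_zero hζ₀ hsepK hb (eval_ne_zero_of_residue hα)
  have hordprod : P.ord (∏ i ∈ T, (genX K K̄ p (fK) - algebraMap K̄ _ (pa i : K̄)) ^ n i) = 0 := by
    rw [ord_prod P T _ fun i _ => pow_ne_zero _ (hxa0 _)]
    refine Finset.sum_eq_zero fun i hi => ?_
    rw [P.ord_pow (hxa0 _)]
    rcases Nat.eq_zero_or_pos (n i) with h0 | hpos
    · rw [h0, Nat.cast_zero, zero_mul]
    · rw [hP, ord_pointPlace_genX_sub_of_ne hζ₀ hsepK hb (hpa i hi hpos).symm, mul_zero]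
  have h := congrArg P.ord hev
  rw [P.ord_mul_eq hu hE0, P.ord_mul_eq (mul_ne_zero (pow_ne_zero _ (hxa0 _)) hprod0) hu'0,
    P.ord_mul_eq (pow_ne_zero _ (hxa0 _)) hprod0, P.ord_pow (hxa0 _), hordE, hordx, hordprod] at h
  simpa using h

omit [NumberField K] hirrκ in
/-- **Full division at one point**: for every `n ≤ v_{(a,b)}(u)` (with `f̄(α) ≠ 0`) there is a factorisation
`u E = (X - a)^n u' (mod Y^p - f_𝒪)` with `E(a, b)` a `𝔓`-unit (iterate the division lemma
`exists_mul_geomSum_eq`; each step is allowed because `u'` still vanishes at `(a, b)`, read off from the orders, and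
`E_b(a, b) = p b^{p-1}` is a `𝔓`-unit). [folklore] -/
theorem exists_mul_eq_pow_mul {u : (absIntegersLocalization 𝔓)[X][Y]} (hu : ev u ≠ 0) {a b : 𝒪}
    (hb : (b : K̄) ^ p = ((fK).map (algebraMap K K̄)).eval (a : K̄))
    (hα : ((fk).map (algebraMap k𝔭 κ)).eval (absIntegersResidue 𝔓 a) ≠ 0) (n : ℕ)
    (hn : (n : ℤ) ≤ (pointPlace K K̄ p (fK) (a : K̄) (b : K̄)).ord (ev u)) :
    ∃ E u' q : (absIntegersLocalization 𝔓)[X][Y], absIntegersResidue 𝔓 (E.evalEval a b) ≠ 0 ∧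
      u * E = C (X - C a) ^ n * u' + gmod * q := by
  have hbres : absIntegersResidue 𝔓 b ≠ 0 := fun h0 => hα (by
    rw [← residue_pow_eq_eval (𝔭 := 𝔭) hb, h0, zero_pow hp.out.ne_zero])
  induction n with
  | zero => exact ⟨1, u, 0, by rw [evalEval, eval_one, eval_one, map_one]; exact one_ne_zero, by ring⟩
  | succ n ih =>
    obtain ⟨E, u', q, hE, heq⟩ := ih (by push_cast at hn ⊢; omega)
    -- `u'` still vanishes at `(a, b)`
    have heq' : u * E = (C (X - C a) ^ n * ∏ i ∈ (∅ : Finset Unit), C (X - C ((fun _ => a) i)) ^ ((fun _ => 0) i)) * u' +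
        gmod * q := by rw [Finset.prod_empty, mul_one]; exact heq
    obtain ⟨hu'0, hordeq⟩ := ord_eq_add_ord_of_mul_eq hζ₀ hsepK hu hb hα hE (∅ : Finset Unit) (fun _ => a)
      (fun _ => 0) (fun _ h => absurd h (Finset.notMem_empty _)) n heq'
    have hpos : 0 < (pointPlace K K̄ p (fK) (a : K̄) (b : K̄)).ord (ev u') := by push_cast at hn; omega
    have hval : u'.evalEval a b = 0 := (ord_ev_pos_iff hζ₀ hsepK hb hu'0).1 hpos
    -- divide once more
    obtain ⟨u'', q', hdiv⟩ := exists_mul_geomSum_eq (R := absIntegersLocalization 𝔓) hval (pow_eq_eval_fLoc hb)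
    set Eb : (absIntegersLocalization 𝔓)[X][Y] := ∑ i ∈ Finset.range p, (X : (absIntegersLocalization 𝔓)[X][Y]) ^ i *
      C (C b) ^ (p - 1 - i) with hEb
    refine ⟨E * Eb, u'', q * Eb + C (X - C a) ^ n * q', ?_, ?_⟩
    · rw [← coe_evalEvalRingHom, map_mul, coe_evalEvalRingHom, hEb, evalEval_geomSum, map_mul,
        map_mul, map_pow, map_natCast]
      exact mul_ne_zero hE (mul_ne_zero (natCast_residue_ne_zero hp𝔭) (pow_ne_zero _ hbres))
    · calc u * (E * Eb) = (u * E) * Eb := by ring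
        _ = (C (X - C a) ^ n * u' + gmod * q) * Eb := by rw [heq]
        _ = C (X - C a) ^ n * (u' * Eb) + gmod * q * Eb := by ring
        _ = C (X - C a) ^ n * (C (X - C a) * u'' + gmod * q') + gmod * q * Eb := by rw [hdiv]
        _ = C (X - C a) ^ (n + 1) * u'' + gmod * (q * Eb + C (X - C a) ^ n * q') := by ring

omit [NumberField K] hirrκ in
/-- **Division at all the points of a residue disc**.  Let `T` be a finite set of places of `K̄(C_f)`, each the
place of a `𝔓`-integral point `pt Q = (a_Q, b_Q)` reducing to the same unramified point `(α, β)` of the special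
fibre (`f̄(α) ≠ 0`).  Then `u E = ∏_{Q ∈ T} (X - a_Q)^{v_Q(u)} · u' (mod Y^p - f_𝒪)` with `Ē(α, β) ≠ 0`: the points
have pairwise distinct `x`-coordinates (`eq_of_residue_eq`), so the divisions at the different points do not interact.
[folklore] -/
theorem exists_mul_eq_prod_pow_mul {u : (absIntegersLocalization 𝔓)[X][Y]} (hu : ev u ≠ 0) {α β : κ}
    (hα : ((fk).map (algebraMap k𝔭 κ)).eval α ≠ 0) (pt : PlaceOver K̄ FK → 𝒪 × 𝒪) (T : Finset (PlaceOver K̄ FK))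
    (hT : ∀ Q ∈ T, ((pt Q).2 : K̄) ^ p = ((fK).map (algebraMap K K̄)).eval ((pt Q).1 : K̄) ∧
      Q = pointPlace K K̄ p (fK) ((pt Q).1 : K̄) ((pt Q).2 : K̄) ∧
      absIntegersResidue 𝔓 (pt Q).1 = α ∧ absIntegersResidue 𝔓 (pt Q).2 = β) :
    ∃ E u' q : (absIntegersLocalization 𝔓)[X][Y],
      (E.map (mapRingHom (absIntegersResidue 𝔓))).evalEval α β ≠ 0 ∧
      u * E = (∏ Q ∈ T, C (X - C (pt Q).1) ^ (Q.ord (ev u)).toNat) * u' + gmod * q := by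
  induction T using Finset.induction_on with
  | empty =>
    refine ⟨1, u, 0, ?_, by rw [Finset.prod_empty]; ring⟩
    rw [Polynomial.map_one, evalEval, eval_one, eval_one]; exact one_ne_zero
  | insert Q₀ T hQ₀ ih =>
    obtain ⟨E, u', q, hE, heq⟩ := ih fun Q hQ => hT Q (Finset.mem_insert_of_mem hQ)
    obtain ⟨hb₀, hQ₀eq, ha₀, hb₀'⟩ := hT Q₀ (Finset.mem_insert_self Q₀ T)
    set a₀ := (pt Q₀).1 with ha₀def
    set b₀ := (pt Q₀).2 with hb₀def
    have hα₀ : ((fk).map (algebraMap k𝔭 κ)).eval (absIntegersResidue 𝔓 a₀) ≠ 0 := by rwa [ha₀]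
    -- `E(a₀, b₀)` is a `𝔓`-unit
    have hE₀ : absIntegersResidue 𝔓 (E.evalEval a₀ b₀) ≠ 0 := by
      rwa [← evalEval_map_residue, ha₀, hb₀']
    -- the other points have different `x`-coordinates
    have hpa : ∀ Q ∈ T, 0 < (Q.ord (ev u)).toNat → ((pt Q).1 : K̄) ≠ a₀ := by
      intro Q hQ _ heqx
      obtain ⟨hbQ, hQeq, haQ, hbQ'⟩ := hT Q (Finset.mem_insert_of_mem hQ)
      have hx : (pt Q).1 = a₀ := Subtype.ext heqx
      rw [hx] at hbQ
      have hy : (pt Q).2 = b₀ := eq_of_residue_eq hp𝔭 hbQ hb₀ hα₀ (by rw [hbQ', hb₀'])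
      apply hQ₀
      rw [hQ₀eq, ← hx, ← hy, ← hQeq]
      exact hQ
    -- `v_{Q₀}(u') = v_{Q₀}(u)`
    have heq' : u * E = (C (X - C a₀) ^ 0 * ∏ Q ∈ T, C (X - C ((fun Q => (pt Q).1) Q)) ^ ((fun Q => (Q.ord (ev u)).toNat) Q)) *
        u' + gmod * q := by rw [pow_zero, one_mul]; exact heq
    obtain ⟨hu'0, hord⟩ := ord_eq_add_ord_of_mul_eq hζ₀ hsepK hu hb₀ hα₀ hE₀ T (fun Q => (pt Q).1)
      (fun Q => (Q.ord (ev u)).toNat) hpa 0 heq'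
    rw [Nat.cast_zero, zero_add, ← hQ₀eq] at hord
    -- divide at `Q₀` with full multiplicity
    obtain ⟨E₀, u'', q₀, hE₀', hdiv⟩ := exists_mul_eq_pow_mul hp𝔭 hζ₀ hsepK hu'0 hb₀ hα₀ (Q₀.ord (ev u)).toNat (by
      rw [← hQ₀eq]
      rw [← hord, Int.toNat_of_nonneg]
      rw [hord, hQ₀eq]
      exact ord_ev_nonneg hζ₀ hsepK hb₀ hu'0)
    refine ⟨E * E₀, u'', q * E₀ + (∏ Q ∈ T, C (X - C (pt Q).1) ^ (Q.ord (ev u)).toNat) * q₀, ?_, ?_⟩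
    · rw [Polynomial.map_mul, ← coe_evalEvalRingHom, map_mul, coe_evalEvalRingHom]
      refine mul_ne_zero hE ?_
      rwa [← ha₀, ← hb₀', evalEval_map_residue]
    · rw [Finset.prod_insert hQ₀]
      calc u * (E * E₀) = (u * E) * E₀ := by ring
        _ = ((∏ Q ∈ T, C (X - C (pt Q).1) ^ (Q.ord (ev u)).toNat) * u' + gmod * q) * E₀ := by rw [heq]
        _ = (∏ Q ∈ T, C (X - C (pt Q).1) ^ (Q.ord (ev u)).toNat) * (u' * E₀) + gmod * q * E₀ := by ring
        _ = (∏ Q ∈ T, C (X - C (pt Q).1) ^ (Q.ord (ev u)).toNat) * (C (X - C a₀) ^ (Q₀.ord (ev u)).toNat * u'' +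
              gmod * q₀) + gmod * q * E₀ := by rw [hdiv]
        _ = _ := by ring

end Local

/-! ### The local inequality: `∑_{Q ↦ Q̄} v_Q(u) ≤ v_{Q̄}(ū)` at unramified `Q̄` -/

/-- **The local inequality of the reduction at an unramified point.**  For `u ∈ ℤ̄_𝔓[X][Y]` with `ū(x,y) ≠ 0` and an
unramified affine point `Q̄ = (α, β)` of the special fibre (`f̄(α) ≠ 0`), the total order of `u(x,y)` at the places of
`K̄(C_f)` reducing to `Q̄` is at most the order of `ū(x,y)` at `Q̄`: reduce the factorisation
`u E = ∏ (X - a_Q)^{v_Q(u)} u'` modulo `𝔓`, where every `X - a_Q` becomes the uniformizer `x - α` of `Q̄`. [cite: Deuring1942Reduktion, §3] -/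
theorem sum_ord_le_ord_of_redPlace_eq (hp𝔭 : (p : 𝓞 K) ∉ 𝔭.asIdeal) {ζ₀ : K̄} (hζ₀ : IsPrimitiveRoot ζ₀ p)
    {ζ₀' : κ} (hζ₀' : IsPrimitiveRoot ζ₀' p) (hsepK : (fK).Separable) (hsepk : (fk).Separable)
    {u : (absIntegersLocalization 𝔓)[X][Y]} (hu : evκ u ≠ 0) {α β : κ}
    (hαβ : β ^ p = ((fk).map (algebraMap k𝔭 κ)).eval α) (hα : ((fk).map (algebraMap k𝔭 κ)).eval α ≠ 0) :
    ∑ Q ∈ (principalDivisor K̄ (ev u)).support.filter (fun Q => redPlace 𝔭 𝔓 Q = pointPlace k𝔭 κ p (fk) α β),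
        Q.ord (ev u) ≤ (pointPlace k𝔭 κ p (fk) α β).ord (evκ u) := by
  haveI : IsAlgClosed κ := absIntegers.isAlgClosed_quotient 𝔓
  have hu0 : ev u ≠ 0 := ev_ne_zero_of_evκ_ne_zero hu
  -- lifts of `(α, β)`
  obtain ⟨a', rfl⟩ := absIntegersResidue_surjective 𝔓 α
  obtain ⟨b', rfl⟩ := absIntegersResidue_surjective 𝔓 β
  set Q' := pointPlace k𝔭 κ p (fk) (absIntegersResidue 𝔓 a') (absIntegersResidue 𝔓 b') with hQ'
  set T := (principalDivisor K̄ (ev u)).support.filter (fun Q => redPlace 𝔭 𝔓 Q = Q') with hT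
  -- the integral points of the places of `T`
  have hex : ∀ Q ∈ T, ∃ ab : 𝒪 × 𝒪, (ab.2 : K̄) ^ p = ((fK).map (algebraMap K K̄)).eval (ab.1 : K̄) ∧
      Q = pointPlace K K̄ p (fK) (ab.1 : K̄) (ab.2 : K̄) := by
    intro Q hQ
    have hred : redPlace 𝔭 𝔓 Q = Q' := (Finset.mem_filter.1 hQ).2
    obtain ⟨a, b, hb, rfl⟩ := exists_eq_pointPlace_of_redPlace_ne_inftyPlace (𝔭 := 𝔭) (𝔓 := 𝔓)
      (Q := Q) (by rw [hred, hQ']; exact pointPlace_ne_inftyPlace hζ₀' hsepk hαβ)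
    exact ⟨(a, b), hb, rfl⟩
  choose! pt hpt using hex
  have hT' : ∀ Q ∈ T, ((pt Q).2 : K̄) ^ p = ((fK).map (algebraMap K K̄)).eval ((pt Q).1 : K̄) ∧
      Q = pointPlace K K̄ p (fK) ((pt Q).1 : K̄) ((pt Q).2 : K̄) ∧
      absIntegersResidue 𝔓 (pt Q).1 = absIntegersResidue 𝔓 a' ∧ absIntegersResidue 𝔓 (pt Q).2 = absIntegersResidue 𝔓 b' := by
    intro Q hQ
    obtain ⟨hb, hQeq⟩ := hpt Q hQ
    have hred : redPlace 𝔭 𝔓 Q = Q' := (Finset.mem_filter.1 hQ).2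
    rw [hQeq, redPlace_pointPlace hζ₀ hsepK _ _ hb, hQ'] at hred
    obtain ⟨h1, h2⟩ := pointPlace_inj hζ₀' hsepk (residue_pow_eq_eval hb) hαβ hred
    exact ⟨hb, hQeq, h1, h2⟩
  -- divide
  obtain ⟨E, u', q, hE, heq⟩ := exists_mul_eq_prod_pow_mul hp𝔭 hζ₀ hsepK hu0 hα pt T hT'
  -- evaluate in the special fibre
  have hb'' : absIntegersResidue 𝔓 b' ^ p = ((fk).map (algebraMap k𝔭 κ)).eval (absIntegersResidue 𝔓 a') := hαβ
  have hev : evκ u * evκ E = (genX k𝔭 κ p (fk) - algebraMap κ _ (absIntegersResidue 𝔓 a')) ^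
      (∑ Q ∈ T, (Q.ord (ev u)).toNat) * evκ u' := by
    have h := congrArg (fun w => evκ w) heq
    simp only [map_mul, map_add, map_prod, map_pow, evκ_gmod, zero_mul, add_zero] at h
    rw [h, ← Finset.prod_pow_eq_pow_sum]
    congr 1
    refine Finset.prod_congr rfl fun Q hQ => ?_
    rw [polyEval_C_X_sub_C, (hT' Q hQ).2.2.1]
  have hE0 : evκ E ≠ 0 := by
    intro h0
    have h1 : Q'.valuation (evκ E) < 1 := by rw [h0, Valuation.map_zero]; exact zero_lt_one
    rw [hQ', valuation_polyEval_lt_one_iff _ hζ₀' hsepk hb'', ← evalEval_map_residue] at h1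
    exact hE h1
  have hxa0 : genX k𝔭 κ p (fk) - algebraMap κ _ (absIntegersResidue 𝔓 a') ≠ 0 := genX_sub_algebraMap_ne_zero _ _ _ _ _
  have hu'0 : evκ u' ≠ 0 := by
    intro h0; rw [h0, mul_zero] at hev; exact mul_ne_zero hu hE0 hev
  have hordE : Q'.ord (evκ E) = 0 := by
    rw [hQ', ord_polyEval_eq_zero_iff _ hζ₀' hsepk hb'' hE0, ← evalEval_map_residue]
    exact hE
  have hordx : Q'.ord (genX k𝔭 κ p (fk) - algebraMap κ _ (absIntegersResidue 𝔓 a')) = 1 :=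
    ord_pointPlace_genX_sub_of_eval_ne_zero hζ₀' hsepk hb'' hα
  have hordu' : 0 ≤ Q'.ord (evκ u') := ord_polyEval_nonneg _ hζ₀' hsepk hb'' hu'0
  have h := congrArg Q'.ord hev
  rw [Q'.ord_mul_eq hu hE0, Q'.ord_mul_eq (pow_ne_zero _ hxa0) hu'0, Q'.ord_pow hxa0, hordE, hordx, mul_one] at h
  -- the exponents are the orders
  have hsum : ∑ Q ∈ T, Q.ord (ev u) = ∑ Q ∈ T, ((Q.ord (ev u)).toNat : ℤ) := by
    refine Finset.sum_congr rfl fun Q hQ => ?_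
    obtain ⟨hb, hQeq, -, -⟩ := hT' Q hQ
    rw [Int.toNat_of_nonneg]
    rw [hQeq]
    exact ord_ev_nonneg hζ₀ hsepK hb hu0
  rw [hsum, ← Nat.cast_sum]
  omega

end SuperellipticReduction

end Literature.NumberTheory.GaloisRepresentations
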